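import Literature.Analysis.FluidPDE.ForwardDSSCylinderLimit
import Literature.Analysis.FluidPDE.ForwardDSSRepresentative
import Literature.Analysis.FluidPDE.SuitableWeakCongr
import Mathlib.MeasureTheory.Function.ConvergenceInMeasure
import Mathlib.MeasureTheory.Function.AEEqOfIntegral
import HarnessLib

/-!
# Forward DSS solutions: the DSS bookkeeping of Bradshaw–Tsai 2019, §4.2–§4.3 (proofs)

Analysis/FluidPDE proof file (no new definitions) over `ForwardDSSCylinderLimit.lean` (the
DSS-free compactness fact `bradshawTsai2019_cylinderLimit`), `ForwardDSSExistenceLocal.lean`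
(`bradshawTsai2019_limit_4_3_local`, `IsBradshawTsai2019LocalSolution`) and
`ForwardDSSRepresentative.lean` (scaling-invariant representatives). Main result:

* `bradshawTsai2019_limit_4_3_local_of_cylinderLimit :
    bradshawTsai2019_cylinderLimit → bradshawTsai2019_limit_4_3_local`,
  whence `bradshawTsai2019_dss_existence_of_cylinderLimit`: Theorem 1.2
  (`bradshawTsai2019_dss_existence`) from Lemma 4.1, Prop. 3.1 (dss) and the DSS-free compactness
  fact — a trust base without any self-similar content beyond Lemma 4.1 and Prop. 3.1.

That is, everything self-similar in the limit step of Bradshaw–Tsai, Analysis & PDE 12 (2019),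
§4.3 (arXiv:1801.08060 p. 12) is *proved* here from the DSS-free compactness statement:

1. the limit velocity class is DSS a.e. on the unit cylinder `W = (0,T) × B₁`
   (`ae_dss_velocity_of_tendsto`: strong `L²(W)` convergence of the `λ`-DSS `vₖ` gives an a.e.
   convergent subsequence, transported along the shrinking `(t,x) ↦ (t/λ², x/λ)` which maps `W`
   into itself);
2. the limit pressure class is DSS a.e. on `W` (`ae_dss_pressure_of_tendsto`: weak `L^{3/2}(W)`
   convergence of the `λ`-DSS `πₖ` tested against indicators, change of variables, and
   `∫_A (p∘S − λ²p) = 0` for all measurable `A ⊆ W`);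
3. modification of the limit velocity on a null, scaling-closed set of times (slices replaced by
   the DSS datum `v₀`) makes the a.e. identity hold on *every* time slice
   (`exists_sliceDSS_modification`), without touching the every-`t` datum clause;
4. the scaling-invariant representatives `dssExtend` of velocity (weight `λ`) and pressure
   (weight `λ²`) from the top layer of `W` are `λ`-DSS on `ℝ × ℝ³`, agree with the limit a.e. on
   `W` (so suitability and the three bounds transfer by `IsSuitableWeakSolutionOn.congr_ae`) and,
   for the velocity, agree with the modified limit a.e. on *every* slice `t ∈ (0,T)`, so the datum
   clause transfers verbatim — this is §4.2's "if a solution is DSS in a neighborhood of the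
   origin, then it can be extended to a DSS solution on `ℝ³ × (0,∞)`" for the tree's pointwise
   rendering of DSS.

## References

* Z. Bradshaw, T.-P. Tsai, Analysis & PDE 12 (2019) = arXiv:1801.08060, §4.2, §4.3 (proof of
  Thm 1.2) [BradshawTsai2019].
-/

noncomputable section

open MeasureTheory TopologicalSpace Set Function Filter Metric Module
open scoped InnerProductSpace RealInnerProductSpace ENNReal NNReal Topology

namespace Literature.Analysis.FluidPDE

namespace BradshawTsai2019

variable {E : Type*} [NormedAddCommGroup E] [InnerProductSpace ℝ E] [FiniteDimensional ℝ E]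
  [MeasurableSpace E] [BorelSpace E]

/-! ### 1. The limit velocity is DSS a.e. -/

section Velocity

/-- **A strong `L²` limit of `c`-DSS fields is `c`-DSS almost everywhere on the cylinder**: if
`vₖ → u` in `L²(W)`, `W = (0,T) × B_r` (`∫∫_W ‖vₖ − u‖² → 0`), each `vₖ` is `c`-DSS (`c ≥ 1`, so
that the shrinking `S : (t,x) ↦ (t/c², x/c)` maps `W` into itself) and everything is measurable
on `W`, then `u (S w) = c • u (w)` for a.e. `w ∈ W` (a subsequence converges a.e.; transport the
null set along `S`; `vₖ (S w) = c • vₖ (w)` identically). [cite: BradshawTsai2019, §4.3 (proof of Thm 1.2: "v can be extended to a DSS solution")] -/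
theorem ae_dss_velocity_of_tendsto {c : ℝ} (hc : 1 ≤ c) {T r : ℝ} {v : ℕ → ℝ → E → E}
    {u : ℝ → E → E} (hdss : ∀ k, IsDiscretelySelfSimilar c (v k))
    (hvm : ∀ k, AEStronglyMeasurable (uncurry (v k))
      (volume.restrict (Ioo (0 : ℝ) T ×ˢ ball (0 : E) r)))
    (hum : AEStronglyMeasurable (uncurry u) (volume.restrict (Ioo (0 : ℝ) T ×ˢ ball (0 : E) r)))
    (hconv : Tendsto (fun k => ∫⁻ z in Ioo (0 : ℝ) T ×ˢ ball (0 : E) r,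
      ‖v k z.1 z.2 - u z.1 z.2‖ₑ ^ 2) atTop (𝓝 0)) :
    ∀ᵐ w ∂volume, w ∈ Ioo (0 : ℝ) T ×ˢ ball (0 : E) r →
      uncurry u (stDilate c (-1) w) = c • uncurry u w := by
  have hc0 : 0 < c := one_pos.trans_le hc
  set W : Set (ℝ × E) := Ioo (0 : ℝ) T ×ˢ ball (0 : E) r with hW
  set μ : Measure (ℝ × E) := volume.restrict W with hμ
  -- `L²(W)` convergence in `eLpNorm` form
  have h2 : Tendsto (fun k => eLpNorm (uncurry (v k) - uncurry u) 2 μ) atTop (𝓝 0) := by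
    have e : ∀ k, eLpNorm (uncurry (v k) - uncurry u) 2 μ =
        (∫⁻ z in W, ‖v k z.1 z.2 - u z.1 z.2‖ₑ ^ 2) ^ (1 / (2 : ℝ)) := by
      intro k
      rw [eLpNorm_eq_lintegral_rpow_enorm_toReal two_ne_zero ENNReal.ofNat_ne_top,
        ENNReal.toReal_ofNat, one_div]
      congr 1
      refine lintegral_congr fun z => ?_
      rw [← ENNReal.rpow_natCast]
      rfl
    simp_rw [e]
    have hcont := (ENNReal.continuous_rpow_const (y := 1 / (2 : ℝ))).tendsto 0
    rw [ENNReal.zero_rpow_of_pos (by norm_num)] at hcont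
    exact hcont.comp hconv
  have hmeas := tendstoInMeasure_of_tendsto_eLpNorm two_ne_zero hvm hum h2
  obtain ⟨ns, -, hae⟩ := hmeas.exists_seq_tendsto_ae
  -- implication form and transport along the shrinking
  have hae' : ∀ᵐ w ∂volume, w ∈ W → Tendsto (fun i => uncurry (v (ns i)) w) atTop
      (𝓝 (uncurry u w)) := ae_imp_of_ae_restrict hae
  have htr := ae_comp_stDilate (E := E) hc0 hae' (-1)
  filter_upwards [hae', htr] with w hw hw' hwW
  have hSw : stDilate c (-1) w ∈ W := stDilate_neg_one_mem_cylinder hc T r w hwW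
  have hlim1 := hw' hSw
  have hlim2 : Tendsto (fun i => uncurry (v (ns i)) (stDilate c (-1) w)) atTop
      (𝓝 (c • uncurry u w)) := by
    have e : (fun i => uncurry (v (ns i)) (stDilate c (-1) w)) =
        fun i => c • uncurry (v (ns i)) w :=
      funext fun i => apply_stDilate_neg_one_of_isDiscretelySelfSimilar hc0.ne' (hdss _) w
    rw [e]
    exact (hw hwW).const_smul c
  exact tendsto_nhds_unique hlim1 hlim2

end Velocity

/-! ### 2. The limit pressure is DSS a.e. -/

section Pressure

/-- Weak convergence tested against the indicator of a measurable `B ⊆ W` is convergence of the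
integrals over `B`. [folklore] -/
theorem tendsto_setIntegral_of_weak {W B : Set (ℝ × E)} (hBW : B ⊆ W) (hB : MeasurableSet B)
    (hWfin : volume W ≠ ⊤) {π : ℕ → ℝ → E → ℝ} {p : ℝ → E → ℝ}
    (hweak : ∀ g : ℝ × E → ℝ, MemLp g 3 (volume.restrict W) →
      Tendsto (fun j => ∫ z in W, π j z.1 z.2 * g z) atTop (𝓝 (∫ z in W, p z.1 z.2 * g z))) :
    Tendsto (fun j => ∫ z in B, π j z.1 z.2) atTop (𝓝 (∫ z in B, p z.1 z.2)) := by
  have hg : MemLp (B.indicator fun _ => (1 : ℝ)) 3 (volume.restrict W) := by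
    haveI : IsFiniteMeasure (volume.restrict W) := isFiniteMeasure_restrict.2 hWfin
    exact memLp_indicator_const 3 hB 1 (Or.inr (measure_ne_top _ _))
  have key := hweak _ hg
  have e : ∀ F : ℝ × E → ℝ, ∫ z in W, F z * B.indicator (fun _ => (1 : ℝ)) z = ∫ z in B, F z := by
    intro F
    have hfun : (fun z => F z * B.indicator (fun _ => (1 : ℝ)) z) = B.indicator F := by
      funext z
      by_cases hz : z ∈ B
      · simp [indicator_of_mem hz]
      · simp [indicator_of_notMem hz]
    rw [hfun, setIntegral_indicator hB, inter_eq_right.2 hBW]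
  simp only [e] at key
  exact key

/-- **A weak `L^{3/2}` limit of `c`-DSS pressures is a `c`-DSS pressure almost everywhere on the
cylinder**: if `πₖ ⇀ p` weakly on `W = (0,T) × B_r` (tested against `L³(W)`), each `πₖ` is a
`c`-DSS pressure (`c ≥ 1`; `S : (t,x) ↦ (t/c², x/c)` maps `W` into itself), and `p` is
integrable on `W`, then `p (S w) = c² p (w)` for a.e. `w ∈ W`: for measurable `A ⊆ W`, by the
change of variables `∫_A πₖ∘S = c^{n+2} ∫_{S(A)} πₖ` and `πₖ∘S = c² πₖ`, so in the limit
`∫_A p∘S = c^{n+2} ∫_{S(A)} p = c² ∫_A p`, whence `p∘S − c² p` has vanishing integrals over all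
measurable subsets of `W`. [cite: BradshawTsai2019, §4.3 (proof of Thm 1.2: the limit pressure)] -/
theorem ae_dss_pressure_of_tendsto {c : ℝ} (hc : 1 ≤ c) {T r : ℝ} {π : ℕ → ℝ → E → ℝ}
    {p : ℝ → E → ℝ} (hdss : ∀ k, nsRescalePressure c (π k) = π k)
    (hpi : IntegrableOn (uncurry p) (Ioo (0 : ℝ) T ×ˢ ball (0 : E) r) volume)
    (hweak : ∀ g : ℝ × E → ℝ, MemLp g 3 (volume.restrict (Ioo (0 : ℝ) T ×ˢ ball (0 : E) r)) →
      Tendsto (fun j => ∫ z in Ioo (0 : ℝ) T ×ˢ ball (0 : E) r, π j z.1 z.2 * g z) atTop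
        (𝓝 (∫ z in Ioo (0 : ℝ) T ×ˢ ball (0 : E) r, p z.1 z.2 * g z))) :
    ∀ᵐ w ∂volume, w ∈ Ioo (0 : ℝ) T ×ˢ ball (0 : E) r →
      uncurry p (stDilate c (-1) w) = c ^ 2 * uncurry p w := by
  have hc0 : 0 < c := one_pos.trans_le hc
  set W : Set (ℝ × E) := Ioo (0 : ℝ) T ×ˢ ball (0 : E) r with hW
  have hWm : MeasurableSet W := measurableSet_Ioo.prod measurableSet_ball
  have hWfin : volume W ≠ ⊤ := by
    rw [hW, Measure.volume_eq_prod, Measure.prod_prod]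
    exact ENNReal.mul_ne_top (by simp [Real.volume_Ioo]) measure_ball_lt_top.ne
  -- the shrinking as an affine map
  set β : ℝ := (c ^ (-1 : ℤ)) ^ 2 with hβ
  set γ : ℝ := c ^ (-1 : ℤ) with hγ
  have hγ0 : 0 < γ := zpow_pos hc0 _
  have hβ0 : 0 < β := by positivity
  have hS : (stDilate c (-1) : ℝ × E → ℝ × E) = stAffine β γ 0 (0 : E) :=
    stDilate_eq_stAffine c (-1)
  have hme : MeasurableEmbedding (stAffine β γ 0 (0 : E)) :=
    measurableEmbedding_stAffine hβ0.ne' hγ0.ne' 0 0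
  have hSW : ∀ w ∈ W, stAffine β γ 0 (0 : E) w ∈ W := fun w hw => by
    rw [← hS]; exact stDilate_neg_one_mem_cylinder hc T r w hw
  set J : ℝ := (β * γ ^ finrank ℝ E)⁻¹ with hJ
  -- change of variables over a measurable `A ⊆ W`
  have hcv : ∀ (F : ℝ × E → ℝ) {A : Set (ℝ × E)}, MeasurableSet A →
      ∫ w in A, F (stAffine β γ 0 (0 : E) w) = J • ∫ z in stAffine β γ 0 (0 : E) '' A, F z := by
    intro F A hA
    have := setIntegral_preimage_comp_stAffine hβ0 hγ0 0 (0 : E) F (stAffine β γ 0 (0 : E) '' A)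
    rwa [hme.injective.preimage_image] at this
  -- the identity `∫_A p∘S = c² ∫_A p` for measurable `A ⊆ W`
  have key : ∀ {A : Set (ℝ × E)}, A ⊆ W → MeasurableSet A →
      ∫ w in A, uncurry p (stAffine β γ 0 (0 : E) w) = c ^ 2 * ∫ w in A, uncurry p w := by
    intro A hAW hA
    set B : Set (ℝ × E) := stAffine β γ 0 (0 : E) '' A with hB
    have hBm : MeasurableSet B := hme.measurableSet_image.2 hA
    have hBW : B ⊆ W := by
      rintro _ ⟨w, hw, rfl⟩; exact hSW w (hAW hw)
    -- for each `k`: `J • ∫_B πₖ = c² ∫_A πₖ`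
    have hk : ∀ k, J • ∫ z in B, uncurry (π k) z = c ^ 2 * ∫ w in A, uncurry (π k) w := by
      intro k
      rw [← hcv (uncurry (π k)) hA, ← integral_const_mul]
      refine integral_congr_ae (Eventually.of_forall fun w => ?_)
      have := apply_stDilate_neg_one_of_nsRescalePressure hc0.ne' (hdss k) w
      rwa [hS] at this
    have hlimB := tendsto_setIntegral_of_weak hBW hBm hWfin hweak
    have hlimA := tendsto_setIntegral_of_weak hAW hA hWfin hweak
    have hlim1 : Tendsto (fun k => J • ∫ z in B, uncurry (π k) z) atTop
        (𝓝 (J • ∫ z in B, uncurry p z)) := hlimB.const_smul J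
    have hlim2 : Tendsto (fun k => J • ∫ z in B, uncurry (π k) z) atTop
        (𝓝 (c ^ 2 * ∫ w in A, uncurry p w)) := by
      simp_rw [hk]
      exact hlimA.const_mul (c ^ 2)
    have e := tendsto_nhds_unique hlim1 hlim2
    rw [hcv (uncurry p) hA]
    exact e
  -- `p∘S − c² p` is integrable on `W` with vanishing integrals over measurable subsets
  have hpS : IntegrableOn (fun w => uncurry p (stAffine β γ 0 (0 : E) w)) W volume := by
    have h1 : IntegrableOn (uncurry p ∘ stAffine β γ 0 (0 : E)) (stAffine β γ 0 (0 : E) ⁻¹' W)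
        volume := (integrableOn_comp_stAffine_iff hβ0 hγ0 0 (0 : E) (uncurry p) W).2 hpi
    exact h1.mono_set fun w hw => hSW w hw
  have hpc : IntegrableOn (fun w => c ^ 2 * uncurry p w) W volume := hpi.const_mul (c ^ 2)
  have hdiff : Integrable (fun w => uncurry p (stAffine β γ 0 (0 : E) w) - c ^ 2 * uncurry p w)
      (volume.restrict W) := hpS.sub hpc
  have hzero := hdiff.ae_eq_zero_of_forall_setIntegral_eq_zero (fun s hs _ => by
    rw [Measure.restrict_restrict hs, integral_sub (hpS.mono_set inter_subset_right)
      (hpc.mono_set inter_subset_right), integral_const_mul,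
      key inter_subset_right (hs.inter hWm), sub_self])
  have hzero' : ∀ᵐ w ∂volume, w ∈ W →
      uncurry p (stAffine β γ 0 (0 : E) w) - c ^ 2 * uncurry p w = 0 := ae_imp_of_ae_restrict hzero
  filter_upwards [hzero'] with w hw hwW
  rw [hS]
  exact sub_eq_zero.1 (hw hwW)

end Pressure

/-! ### 3. Modification on a null set of times: the a.e. DSS identity on every slice -/

section Slices

omit [FiniteDimensional ℝ E] [MeasurableSpace E] [BorelSpace E] in
/-- A `c`-DSS datum at the shrunk point: `v₀ (x/c) = c • v₀ (x)` (`c ≠ 0`). [folklore] -/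
theorem apply_inv_smul_of_nsRescaleData_eq {F : Type*} [NormedAddCommGroup F] [NormedSpace ℝ F]
    {c : ℝ} (hc : c ≠ 0) {v₀ : E → F} (h : nsRescaleData c v₀ = v₀) (x : E) :
    v₀ ((c ^ (-1 : ℤ)) • x) = c • v₀ x := by
  have key : c • v₀ (c • (c⁻¹ • x)) = v₀ (c⁻¹ • x) := congrFun h (c⁻¹ • x)
  rw [smul_inv_smul₀ hc] at key
  rw [zpow_neg, zpow_one]
  exact key.symm

/-- **Modification on a null, scaling-closed set of times.** Let `u` satisfy the `c`-DSS identity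
`u (t/c², x/c) = c • u (t, x)` for a.e. `(t, x)` in the cylinder `W = (0,T) × B_r` (`c > 1`), and
let `v₀` be a `c`-DSS datum. Replacing the time slices of `u` over a suitable Lebesgue-null set of
times `N` — the union of the scaling orbit `t ↦ c^{2n} t` of the null set of times at which the
sliced identity fails — by `v₀` produces `u'` with: `u' = u` a.e. on `ℝ × E`; the sliced identity
`u' (t/c², x/c) = c • u' (t, x)` for a.e. `x ∈ B_r` holds for **every** `t ∈ (0,T)`; and every
slice of `u'` is either the corresponding slice of `u` or `v₀`. [folklore] -/
theorem exists_sliceDSS_modification {c : ℝ} (hc : 1 < c) {T r : ℝ} {F : Type*}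
    [NormedAddCommGroup F] [NormedSpace ℝ F] {v₀ : E → F} (hv₀ : nsRescaleData c v₀ = v₀)
    {u : ℝ → E → F}
    (hae : ∀ᵐ w ∂volume, w ∈ Ioo (0 : ℝ) T ×ˢ ball (0 : E) r →
      uncurry u (stDilate c (-1) w) = c • uncurry u w) :
    ∃ u' : ℝ → E → F,
      (∀ᵐ z ∂volume, uncurry u' z = uncurry u z) ∧
      (∀ t ∈ Ioo (0 : ℝ) T, ∀ᵐ x ∂volume, x ∈ ball (0 : E) r →
        uncurry u' (stDilate c (-1) (t, x)) = c • uncurry u' (t, x)) ∧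
      (∀ t, u' t = u t ∨ u' t = v₀) := by
  classical
  have hc0 : 0 < c := one_pos.trans hc
  have hc0' : c ≠ 0 := hc0.ne'
  set W : Set (ℝ × E) := Ioo (0 : ℝ) T ×ˢ ball (0 : E) r with hW
  -- the sliced identity holds at a.e. time
  set P : ℝ → Prop := fun t => ∀ᵐ x ∂volume, ((t, x) : ℝ × E) ∈ W →
    uncurry u (stDilate c (-1) (t, x)) = c • uncurry u (t, x) with hP
  have hPae : ∀ᵐ t ∂volume, P t := by
    have h' : ∀ᵐ z : ℝ × E ∂(volume : Measure ℝ).prod (volume : Measure E),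
        z ∈ W → uncurry u (stDilate c (-1) z) = c • uncurry u z := by
      rwa [← Measure.volume_eq_prod]
    exact Measure.ae_ae_of_ae_prod (p := fun z : ℝ × E =>
      z ∈ W → uncurry u (stDilate c (-1) z) = c • uncurry u z) h'
  set B₀ : Set ℝ := {t | ¬ P t} with hB₀
  have hB₀null : volume B₀ = 0 := ae_iff.1 hPae
  -- the scaling-closed null set of bad times
  set N : Set ℝ := ⋃ n : ℤ, (fun t => (c ^ 2) ^ n * t) ⁻¹' B₀ with hN
  have hNnull : volume N = 0 := by
    refine measure_iUnion_null fun n => ?_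
    rw [Real.volume_preimage_mul_left (zpow_ne_zero n (pow_ne_zero 2 hc0')), hB₀null, mul_zero]
  have hNmem : ∀ t, t ∈ N ↔ ∃ n : ℤ, (c ^ 2) ^ n * t ∈ B₀ := fun t => by simp [hN]
  have hNshrink : ∀ t, t ∈ N ↔ (c ^ (-1 : ℤ)) ^ 2 * t ∈ N := by
    intro t
    have e : ∀ n : ℤ, (c ^ 2) ^ n * ((c ^ (-1 : ℤ)) ^ 2 * t) = (c ^ 2) ^ (n - 1) * t := by
      intro n
      rw [← mul_assoc, zpow_sub_one₀ (pow_ne_zero 2 hc0'), zpow_neg, zpow_one, inv_pow]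
    rw [hNmem, hNmem]
    constructor
    · rintro ⟨n, hn⟩
      exact ⟨n + 1, by rwa [e, add_sub_cancel_right]⟩
    · rintro ⟨n, hn⟩
      exact ⟨n - 1, by rwa [e] at hn⟩
  have hNB₀ : ∀ t, t ∉ N → P t := by
    intro t ht
    by_contra hPt
    exact ht ((hNmem t).2 ⟨0, by rw [zpow_zero, one_mul]; exact hPt⟩)
  -- the modification
  refine ⟨fun t x => if t ∈ N then v₀ x else u t x, ?_, ?_, ?_⟩
  · -- `u' = u` a.e.
    have hprod : volume (N ×ˢ (univ : Set E)) = 0 := by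
      rw [Measure.volume_eq_prod, Measure.prod_prod, hNnull, zero_mul]
    filter_upwards [measure_eq_zero_iff_ae_notMem.1 hprod] with z hz
    have hz' : z.1 ∉ N := fun h => hz ⟨h, mem_univ _⟩
    simp only [uncurry, if_neg hz']
  · -- the sliced identity at every time
    intro t ht
    by_cases htN : t ∈ N
    · have htN' : (c ^ (-1 : ℤ)) ^ 2 * t ∈ N := (hNshrink t).1 htN
      refine Eventually.of_forall fun x _ => ?_
      simp only [uncurry, stDilate_apply, if_pos htN, if_pos htN']
      exact apply_inv_smul_of_nsRescaleData_eq hc0' hv₀ x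
    · have htN' : (c ^ (-1 : ℤ)) ^ 2 * t ∉ N := fun h => htN ((hNshrink t).2 h)
      filter_upwards [hNB₀ t htN] with x hx hxr
      have key := hx ⟨ht, hxr⟩
      simp only [uncurry, stDilate_apply, if_neg htN, if_neg htN'] at key ⊢
      exact key
  · intro t
    by_cases htN : t ∈ N
    · right; funext x; simp [htN]
    · left; funext x; simp [htN]

end Slices

end BradshawTsai2019

/-! ### 4. The assembly: `bradshawTsai2019_cylinderLimit → bradshawTsai2019_limit_4_3_local` -/

section Assembly

/-- An `ℝ≥0∞`-valued function with `∫⁻_W f^{3/2} < ∞` on a set of finite measure has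
`∫⁻_W f < ∞` (pointwise `f ≤ 1 + f^{3/2}`). [folklore] -/
theorem lintegral_lt_top_of_lintegral_rpow_three_halves {α : Type*} [MeasurableSpace α]
    {μ : Measure α} [IsFiniteMeasure μ] {f : α → ℝ≥0∞} (h : ∫⁻ a, f a ^ (3 / 2 : ℝ) ∂μ < ⊤) :
    ∫⁻ a, f a ∂μ < ⊤ := by
  have hle : ∀ a, f a ≤ 1 + f a ^ (3 / 2 : ℝ) := by
    intro a
    rcases le_total (f a) 1 with h1 | h1
    · exact h1.trans le_self_add
    · calc f a = f a ^ (1 : ℝ) := (ENNReal.rpow_one _).symm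
        _ ≤ f a ^ (3 / 2 : ℝ) := ENNReal.rpow_le_rpow_of_exponent_le h1 (by norm_num)
        _ ≤ 1 + f a ^ (3 / 2 : ℝ) := le_add_self
  calc ∫⁻ a, f a ∂μ ≤ ∫⁻ a, (1 + f a ^ (3 / 2 : ℝ)) ∂μ := lintegral_mono hle
    _ = μ univ + ∫⁻ a, f a ^ (3 / 2 : ℝ) ∂μ := by
        rw [lintegral_add_left measurable_const, lintegral_const, one_mul]
    _ < ⊤ := ENNReal.add_lt_top.2 ⟨measure_lt_top _ _, h⟩

/-- **Bradshaw–Tsai 2019, §4.3: the limit step with DSS pressures follows from the DSS-free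
compactness statement on the unit cylinder.** Given the data, solutions and pressures of
`bradshawTsai2019_limit_4_3_local`, apply `bradshawTsai2019_cylinderLimit` (subsequence, limit
`(u₁, p₁)` on `W = (0,T) × B₁`); the limit classes are `λ`-DSS a.e. on `W`
(`ae_dss_velocity_of_tendsto`, `ae_dss_pressure_of_tendsto`); modify `u₁` on a null scaling-closed
set of times so that the identity holds on every slice (`exists_sliceDSS_modification`); take the
scaling-invariant representatives from the top layer of `W` (`dssExtend`, weights `λ` and `λ²`):
they are `λ`-DSS on `ℝ × ℝ³`, agree with `(u₁, p₁)` a.e. on `W` — so suitability, the energy,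
dissipation and pressure bounds transfer (`IsSuitableWeakSolutionOn.congr_ae`) — and the velocity
agrees with the modified limit a.e. on every slice `t ∈ (0,T)`, so the datum clause on compact
`K ⊆ B₁` transfers. This is §4.2 ("if a solution is DSS in a neighborhood of the origin, then it
can be extended") and the sentence "`v` can be extended to a DSS solution on `ℝ³ × (0,∞)` (which
we still denote by `v`)" of §4.3, for the tree's pointwise rendering of DSS. [cite: BradshawTsai2019, §4.2 and §4.3 (proof of Thm 1.2)] -/
theorem bradshawTsai2019_limit_4_3_local_of_cylinderLimit (h : bradshawTsai2019_cylinderLimit) :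
    bradshawTsai2019_limit_4_3_local := by
  intro c hc v₀ hm₀ hL2 _hdiv hdss₀ w₀ v π T C hw _hwdiv _hwdss hconv hLL hvdss hπdss hT hE hG hP
  obtain ⟨σ, u₁, p₁, -, hsuit, hen, ⟨G₀, hG₀, hG₀b⟩, hpb, hstrong, hweak, hdatum⟩ :=
    h hm₀ hL2 (fun k => (hw k).aestronglyMeasurable) hconv hLL hT hE hG hP
  have hc0 : 0 < c := one_pos.trans hc
  have hc0' : c ≠ 0 := hc0.ne'
  set W : Set (ℝ × (EuclideanSpace ℝ (Fin 3))) :=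
    Ioo (0 : ℝ) T ×ˢ ball (0 : (EuclideanSpace ℝ (Fin 3))) 1 with hWdef
  have hWm : MeasurableSet W := measurableSet_Ioo.prod measurableSet_ball
  have hWcoe : ((timeCylinder unitBall 0 T : Opens (ℝ × (EuclideanSpace ℝ (Fin 3)))) :
      Set (ℝ × (EuclideanSpace ℝ (Fin 3)))) = W := rfl
  have hWinv :=
    BradshawTsai2019.stDilate_neg_one_mem_cylinder (E := (EuclideanSpace ℝ (Fin 3))) hc.le T 1
  have hWex : ∀ z ∈ W, ∃ j : ℤ, BradshawTsai2019.stDilate c j z ∈ BradshawTsai2019.topLayer c W :=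
    fun z hz => BradshawTsai2019.exists_stDilate_mem_topLayer_cylinder hc hT one_pos hz.1.1
  have hWfin : volume W ≠ ⊤ := by
    rw [hWdef, Measure.volume_eq_prod, Measure.prod_prod]
    exact ENNReal.mul_ne_top (by simp [Real.volume_Ioo]) measure_ball_lt_top.ne
  haveI : IsFiniteMeasure (volume.restrict W) := isFiniteMeasure_restrict.2 hWfin
  -- measurability of the players on `W`
  have hslabW : W ⊆ Ioi (0 : ℝ) ×ˢ (univ : Set (EuclideanSpace ℝ (Fin 3))) :=
    fun z hz => ⟨hz.1.1, mem_univ _⟩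
  have hvm : ∀ k, AEStronglyMeasurable (uncurry (v (σ k))) (volume.restrict W) := fun k =>
    (hLL (σ k)).aestronglyMeasurable.mono_measure (Measure.restrict_mono hslabW le_rfl)
  have hum : AEStronglyMeasurable (uncurry u₁) (volume.restrict W) :=
    hsuit.distributional.1.aestronglyMeasurable
  have hpm : AEStronglyMeasurable (uncurry p₁) (volume.restrict W) :=
    hsuit.distributional.2.2.1.aestronglyMeasurable
  have hpi : IntegrableOn (uncurry p₁) W volume := by
    refine ⟨hpm, ?_⟩
    rw [hasFiniteIntegral_iff_enorm]
    exact lintegral_lt_top_of_lintegral_rpow_three_halves (hpb.trans_lt ENNReal.coe_lt_top)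
  -- 1.–2. the limit classes are DSS a.e. on `W`
  have hae_u := BradshawTsai2019.ae_dss_velocity_of_tendsto hc.le (fun k => hvdss (σ k)) hvm hum
    hstrong
  have hae_p := BradshawTsai2019.ae_dss_pressure_of_tendsto hc.le (fun k => hπdss (σ k)) hpi hweak
  -- 3. modification of the velocity on a null set of times
  obtain ⟨u₂, hu₂ae, hu₂slice, hu₂dich⟩ :=
    BradshawTsai2019.exists_sliceDSS_modification (E := (EuclideanSpace ℝ (Fin 3))) (r := 1) hc
      hdss₀ hae_u
  have hae_u₂ : ∀ᵐ w ∂volume, w ∈ W →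
      uncurry u₂ (BradshawTsai2019.stDilate c (-1) w) = c • uncurry u₂ w := by
    filter_upwards [hae_u, hu₂ae,
      BradshawTsai2019.ae_comp_stDilate (E := (EuclideanSpace ℝ (Fin 3))) hc0 hu₂ae (-1)]
      with w h1 h2 h3 hwW
    rw [h3, h2]
    exact h1 hwW
  -- 4. the scaling-invariant representatives
  set u : ℝ → (EuclideanSpace ℝ (Fin 3)) → (EuclideanSpace ℝ (Fin 3)) := fun t x =>
    BradshawTsai2019.dssExtend c c W (uncurry u₂) (t, x) with hudef
  set p : ℝ → (EuclideanSpace ℝ (Fin 3)) → ℝ := fun t x =>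
    BradshawTsai2019.dssExtend c (c ^ 2) W (uncurry p₁) (t, x) with hpdef
  have hu_dss : IsDiscretelySelfSimilar c u :=
    BradshawTsai2019.isDiscretelySelfSimilar_dssExtend hc0' hWinv (uncurry u₂)
  have hp_dss : nsRescalePressure c p = p :=
    BradshawTsai2019.nsRescalePressure_dssExtend hc0' hWinv (uncurry p₁)
  -- a.e. agreement on `W`
  have hu_u₂ : ∀ᵐ w ∂volume, w ∈ W → uncurry u w = uncurry u₂ w :=
    BradshawTsai2019.dssExtend_ae_eq_of_ae hc0 hWinv hWex hae_u₂
  have hp_p₁ : ∀ᵐ w ∂volume, w ∈ W → uncurry p w = uncurry p₁ w := by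
    refine BradshawTsai2019.dssExtend_ae_eq_of_ae hc0 hWinv hWex ?_
    filter_upwards [hae_p] with w hw hwW
    rw [smul_eq_mul]
    exact hw hwW
  have hu_r : ∀ᵐ z ∂(volume.restrict W), uncurry u₁ z = uncurry u z := by
    rw [ae_restrict_iff' hWm]
    filter_upwards [hu_u₂, hu₂ae] with z h1 h2 hzW
    rw [h1 hzW, h2]
  have hp_r : ∀ᵐ z ∂(volume.restrict W), uncurry p₁ z = uncurry p z := by
    rw [ae_restrict_iff' hWm]
    filter_upwards [hp_p₁] with z h1 hzW
    rw [h1 hzW]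
  -- suitability transfers
  have hsuit' : IsSuitableWeakSolutionOn (timeCylinder unitBall 0 T) 1 0 u p :=
    hsuit.congr_ae hu_r hp_r
  -- the energy bound transfers (a.e. in time)
  have hen' : ∀ᵐ t ∂(volume.restrict (Ioo 0 T)),
      ∫⁻ x in ball (0 : (EuclideanSpace ℝ (Fin 3))) 1, ‖u t x‖ₑ ^ 2 ≤ C := by
    have hprod : ∀ᵐ z : ℝ × (EuclideanSpace ℝ (Fin 3)) ∂(volume : Measure ℝ).prod
        (volume : Measure (EuclideanSpace ℝ (Fin 3))), z ∈ W → uncurry u₁ z = uncurry u z := by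
      rw [← Measure.volume_eq_prod]
      exact ae_imp_of_ae_restrict hu_r
    have h2 := Measure.ae_ae_of_ae_prod
      (p := fun z : ℝ × (EuclideanSpace ℝ (Fin 3)) => z ∈ W → uncurry u₁ z = uncurry u z) hprod
    filter_upwards [hen, ae_restrict_of_ae (s := Ioo (0 : ℝ) T) h2,
      ae_restrict_mem measurableSet_Ioo] with t ht ht' htI
    calc ∫⁻ x in ball (0 : (EuclideanSpace ℝ (Fin 3))) 1, ‖u t x‖ₑ ^ 2
        = ∫⁻ x in ball (0 : (EuclideanSpace ℝ (Fin 3))) 1, ‖u₁ t x‖ₑ ^ 2 := by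
          refine setLIntegral_congr_fun_ae measurableSet_ball ?_
          filter_upwards [ht'] with x hx hxB
          have e : uncurry u₁ (t, x) = uncurry u (t, x) := hx ⟨htI, hxB⟩
          simp only [uncurry] at e
          rw [e]
      _ ≤ C := ht
  -- the pressure bound transfers
  have hpb' :
      ∫⁻ z in Ioo 0 T ×ˢ ball (0 : (EuclideanSpace ℝ (Fin 3))) 1,
        ‖p z.1 z.2‖ₑ ^ (3 / 2 : ℝ) < ⊤ := by
    calc ∫⁻ z in Ioo 0 T ×ˢ ball (0 : (EuclideanSpace ℝ (Fin 3))) 1,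
          ‖p z.1 z.2‖ₑ ^ (3 / 2 : ℝ)
        = ∫⁻ z in Ioo 0 T ×ˢ ball (0 : (EuclideanSpace ℝ (Fin 3))) 1,
          ‖p₁ z.1 z.2‖ₑ ^ (3 / 2 : ℝ) := by
          refine lintegral_congr_ae ?_
          filter_upwards [hp_r] with z hz
          have e : p₁ z.1 z.2 = p z.1 z.2 := hz
          rw [e]
      _ < ⊤ := hpb.trans_lt ENNReal.coe_lt_top
  -- the datum clause transfers along every slice
  have hslice : ∀ t ∈ Ioo (0 : ℝ) T,
      ∀ᵐ x ∂volume, x ∈ ball (0 : (EuclideanSpace ℝ (Fin 3))) 1 → u t x = u₂ t x :=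
    fun t ht => BradshawTsai2019.dssExtend_slice_ae_eq hc hT one_pos hu₂slice ht
  have hdatum' : ∀ K : Set (EuclideanSpace ℝ (Fin 3)), IsCompact K → K ⊆ ball 0 1 →
      Tendsto (fun t => ∫⁻ x in K, ‖u t x - v₀ x‖ₑ ^ 2) (𝓝[>] 0) (𝓝 0) := by
    intro K hK hKB
    -- the modified limit attains the datum
    have h₂ : Tendsto (fun t => ∫⁻ x in K, ‖u₂ t x - v₀ x‖ₑ ^ 2) (𝓝[>] 0) (𝓝 0) := by
      refine tendsto_of_tendsto_of_tendsto_of_le_of_le tendsto_const_nhds (hdatum K hK hKB)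
        (fun _ => bot_le) fun t => ?_
      rcases hu₂dich t with e | e
      · simp only [e, le_refl]
      · simp only [e, sub_self, enorm_zero, ne_eq, OfNat.ofNat_ne_zero, not_false_eq_true,
          zero_pow, lintegral_const, zero_mul, zero_le]
    refine h₂.congr' ?_
    have hmem : Ioo (0 : ℝ) T ∈ 𝓝[>] (0 : ℝ) := Ioo_mem_nhdsGT hT
    filter_upwards [hmem] with t ht
    refine (setLIntegral_congr_fun_ae hK.isClosed.measurableSet ?_).symm
    filter_upwards [hslice t ht] with x hx hxK
    rw [hx (hKB hxK)]
  exact ⟨u, p, hu_dss, hp_dss, hsuit', ⟨C, hen'⟩, ⟨G₀, hG₀.congr_ae hu_r, hG₀b.trans_lt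
    ENNReal.coe_lt_top⟩, hpb', hdatum'⟩

/-- **Bradshaw–Tsai 2019, Theorem 1.2 from Lemma 4.1, Proposition 3.1 (with the DSS pressure)
and the DSS-free compactness statement on the unit cylinder**:
`bradshawTsai2019_dss_existence_of_local_parts` composed with
`bradshawTsai2019_limit_4_3_local_of_cylinderLimit`. Trust base of `bradshawTsai2019_dss_existence`
in the tree: `{bradshawTsai2019_lemma_4_1, bradshawTsai2019_prop_3_1_dss,
bradshawTsai2019_cylinderLimit}`. [cite: BradshawTsai2019, Thm 1.2 (proof, §4.3)] -/
theorem bradshawTsai2019_dss_existence_of_cylinderLimit (h41 : bradshawTsai2019_lemma_4_1)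
    (h31 : bradshawTsai2019_prop_3_1_dss) (h : bradshawTsai2019_cylinderLimit) :
    bradshawTsai2019_dss_existence :=
  bradshawTsai2019_dss_existence_of_local_parts h41 h31
    (bradshawTsai2019_limit_4_3_local_of_cylinderLimit h)

end Assembly

end Literature.Analysis.FluidPDE

end
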